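import Mathlib
import HarnessLib
import Summits.RiemannHypothesis.RiemannHypothesis.Theses.RuelleBand
import Literature.Analysis.UnboundedOperators.DiagonalOperatorCompact
import Summits.RiemannHypothesis.RiemannHypothesis.Theorems.AsymptoticCriticalLine.Negative.Ladder

/-!
# RuelleBand / `BandRealisation` from `AsymptoticCriticalLine`: the diagonal model

Route `RiemannHypothesis/RuelleBand`, item stmt-RiemannHypothesis-2062 (`BandRealisation`,
support rank 3), helper file (`--supports`).

`BandRealisation` asks for a complex Hilbert space `H` and a one-parameter group `t ↦ T t` of
bounded operators which is unitary modulo a compact operator at some time `t₀ > 0` and has every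
zero `ρ` of `ζ` in the open critical strip as a joint eigenvalue with character
`t ↦ e^{t(ρ - 1/2)}`. This file proves the CALIBRATION direction of the honest equivalence
`BandRealisation ⟺ AsymptoticCriticalLine` recorded in the route (support
`AsymptoticToRealisation`):

* `exists_diagonalGroup` — for any family `z : ι → ℂ` with bounded real parts tending to `0`
  along the cofinite filter, the diagonal group `T t = diag(e^{t z_i})` on `ℓ²(ι, ℂ)` (in the
  standard Hilbert basis) is a one-parameter group of bounded operators, `T 1 - diag(e^{i Im z_i})`
  is compact (its symbol `e^{i Im z_i}(e^{Re z_i} - 1)` tends to `0`; Halmos, Problem 171, in tree as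
  `HilbertBasis.isCompactOperator_diagonalCLM_of_tendsto_zero`), `diag(e^{i Im z_i})` is unitary,
  and the basis vectors are joint eigenvectors;
* `bandRealisation_of_asymptoticCriticalLine : AsymptoticCriticalLine → BandRealisation` — apply
  this with `ι` the set of zeros of `ζ` in the open strip and `z_ρ = ρ - 1/2`:
  `AsymptoticCriticalLine` says precisely that `Re ρ - 1/2 → 0` along the cofinite filter of `ι`.

So the item `BandRealisation` closes in one line once the crux `AsymptoticCriticalLine`
(stmt-RiemannHypothesis-2063) is proved; conversely (companion file
`RuelleBandBandRealisationEngine.lean`, the Faure–Tsujii engine)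
`BandRealisation → AsymptoticCriticalLine`, so the item carries exactly the content of that open
crux. In particular `RiemannHypothesis → BandRealisation` (`bandRealisation_of_riemannHypothesis`,
through the disprover's `Negative.Ladder.not_riemannHypothesis_of_not_acl`): a refutation of the
item would disprove RH. Mathlib + the tree's `DiagonalOperator(Compact).lean`; no new definitions.
-/

noncomputable section

-- D-0017: `Summit.<S>.<S>.…` is the designed namespace of a single-problem summit.
set_option linter.dupNamespace false

namespace Summit.RiemannHypothesis.RiemannHypothesis.Theorems

open Filter Topology
open scoped ComplexConjugate lp
open Summit.RiemannHypothesis.RiemannHypothesis.Theses.RuelleBand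

section Diagonal

variable {ι 𝕜 E : Type*} [RCLike 𝕜] [NormedAddCommGroup E] [InnerProductSpace 𝕜 E]
  (b : HilbertBasis ι 𝕜 E)

/-- The bounded diagonal functional calculus is additive in the symbol:
`diag(m - n) = diag(m) - diag(n)` (coordinates). [folklore] -/
theorem diagonalCLM_sub (m n : lp (fun _ : ι => 𝕜) ⊤) :
    b.diagonalCLM (m - n) = b.diagonalCLM m - b.diagonalCLM n := by
  ext x
  apply b.repr.injective
  ext i
  simp [sub_mul]

/-- A bounded diagonal operator with unimodular symbol is unitary: `diag(u)† diag(u) =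
diag(ū u) = diag(1) = 1` and symmetrically (Halmos, *A Hilbert Space Problem Book*, Problem 63).
[folklore] -/
theorem diagonalCLM_mem_unitary [CompleteSpace E] (u : lp (fun _ : ι => 𝕜) ⊤)
    (hu : ∀ i, ‖u i‖ = 1) : b.diagonalCLM u ∈ unitary (E →L[𝕜] E) := by
  have h1 : star u * u = 1 := by
    ext i
    rw [lp.infty_coeFn_mul, Pi.mul_apply, lp.star_apply, RCLike.star_def, RCLike.conj_mul, hu,
      lp.infty_coeFn_one, Pi.one_apply]
    simp
  have h2 : u * star u = 1 := by
    ext i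
    rw [lp.infty_coeFn_mul, Pi.mul_apply, lp.star_apply, RCLike.star_def, RCLike.mul_conj, hu,
      lp.infty_coeFn_one, Pi.one_apply]
    simp
  rw [Unitary.mem_iff, ContinuousLinearMap.star_eq_adjoint, b.adjoint_diagonalCLM,
    ← b.diagonalCLM_mul, ← b.diagonalCLM_mul, h1, h2, b.diagonalCLM_one]
  exact ⟨rfl, rfl⟩

end Diagonal

/-- **The diagonal model.** Let `z : ι → ℂ` have bounded real parts tending to `0` along the
cofinite filter. On `ℓ²(ι, ℂ)` with its standard Hilbert basis `(e_i)`, the diagonal operators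
`T t = diag(e^{t z_i})` form a one-parameter group of bounded operators (`‖T t‖ ≤ e^{C|t|}`),
`T 1 - U` is compact for the unitary `U = diag(e^{i Im z_i})` (symbol
`e^{i Im z_i}(e^{Re z_i} - 1) → 0`, Halmos Problem 171), and `T t e_i = e^{t z_i} e_i`.
This is the calibration model of the route's support item `AsymptoticToRealisation`. [folklore] -/
theorem exists_diagonalGroup {ι : Type*} (z : ι → ℂ) (hbdd : ∃ C : ℝ, ∀ i, |(z i).re| ≤ C)
    (hz : Tendsto (fun i => (z i).re) cofinite (𝓝 0)) :
    ∃ T : ℝ → (ℓ²(ι, ℂ) →L[ℂ] ℓ²(ι, ℂ)),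
      T 0 = ContinuousLinearMap.id ℂ _ ∧ (∀ s t : ℝ, T (s + t) = (T s).comp (T t)) ∧
      (∃ t₀ : ℝ, 0 < t₀ ∧ ∃ U : ℓ²(ι, ℂ) →L[ℂ] ℓ²(ι, ℂ),
        U ∈ unitary (ℓ²(ι, ℂ) →L[ℂ] ℓ²(ι, ℂ)) ∧ IsCompactOperator (T t₀ - U)) ∧
      ∀ i : ι, ∃ v : ℓ²(ι, ℂ), v ≠ 0 ∧ ∀ t : ℝ, T t v = Complex.exp ((t : ℂ) * z i) • v := by
  classical
  obtain ⟨C, hC⟩ := hbdd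
  set B : HilbertBasis ι ℂ ℓ²(ι, ℂ) := default
  -- the symbols `t ↦ (e^{t z_i})_i ∈ ℓ^∞`
  have hmem : ∀ t : ℝ, Memℓp (fun i => Complex.exp ((t : ℂ) * z i)) ⊤ := fun t => by
    refine memℓp_infty ⟨Real.exp (|t| * C), ?_⟩
    rintro _ ⟨i, rfl⟩
    dsimp only
    rw [Complex.norm_exp, Complex.re_ofReal_mul]
    refine Real.exp_le_exp.2 ?_
    calc t * (z i).re ≤ |t * (z i).re| := le_abs_self _
      _ = |t| * |(z i).re| := abs_mul _ _
      _ ≤ |t| * C := mul_le_mul_of_nonneg_left (hC i) (abs_nonneg _)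
  set m : ℝ → lp (fun _ : ι => ℂ) ⊤ := fun t => ⟨fun i => Complex.exp ((t : ℂ) * z i), hmem t⟩
    with hm
  have hm_apply : ∀ t i, m t i = Complex.exp ((t : ℂ) * z i) := fun t i => rfl
  have hm0 : m 0 = 1 := by
    ext i
    rw [hm_apply, lp.infty_coeFn_one, Pi.one_apply]
    simp
  have hmadd : ∀ s t, m (s + t) = m s * m t := fun s t => by
    ext i
    rw [lp.infty_coeFn_mul, Pi.mul_apply, hm_apply, hm_apply, hm_apply, ← Complex.exp_add]
    push_cast
    ring_nf
  refine ⟨fun t => B.diagonalCLM (m t), ?_, ?_, ⟨1, one_pos, ?_⟩, ?_⟩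
  · -- `T 0 = 1`
    show B.diagonalCLM (m 0) = _
    rw [hm0, B.diagonalCLM_one]
    rfl
  · -- group law
    intro s t
    show B.diagonalCLM (m (s + t)) = _
    rw [hmadd, B.diagonalCLM_mul]
    rfl
  · -- unitary modulo compact at time `1`: the phase symbol
    have humem : Memℓp (fun i => Complex.exp (((z i).im : ℂ) * Complex.I)) ⊤ := by
      refine memℓp_infty ⟨1, ?_⟩
      rintro _ ⟨i, rfl⟩
      exact (Complex.norm_exp_ofReal_mul_I _).le
    set u : lp (fun _ : ι => ℂ) ⊤ := ⟨fun i => Complex.exp (((z i).im : ℂ) * Complex.I), humem⟩ with hu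
    have hu_apply : ∀ i, u i = Complex.exp (((z i).im : ℂ) * Complex.I) := fun i => rfl
    refine ⟨B.diagonalCLM u, diagonalCLM_mem_unitary B u fun i => ?_, ?_⟩
    · rw [hu_apply]
      exact Complex.norm_exp_ofReal_mul_I _
    show IsCompactOperator ⇑(B.diagonalCLM (m 1) - B.diagonalCLM u)
    rw [← diagonalCLM_sub]
    apply B.isCompactOperator_diagonalCLM_of_tendsto_zero
    -- the symbol of the difference has modulus `|e^{Re z_i} - 1| → 0`
    have key : ∀ i, ‖(m 1 - u) i‖ = |Real.exp (z i).re - 1| := fun i => by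
      rw [lp.coeFn_sub, Pi.sub_apply, hm_apply, hu_apply]
      have hsplit : Complex.exp (↑(1 : ℝ) * z i) =
          ↑(Real.exp (z i).re) * Complex.exp (((z i).im : ℂ) * Complex.I) := by
        rw [Complex.ofReal_exp, ← Complex.exp_add, Complex.ofReal_one, one_mul]
        congr 1
        exact (Complex.re_add_im (z i)).symm
      rw [hsplit, ← sub_one_mul, norm_mul, Complex.norm_exp_ofReal_mul_I, mul_one,
        ← Complex.ofReal_one, ← Complex.ofReal_sub, Complex.norm_real, Real.norm_eq_abs]
    have hcont : Tendsto (fun x : ℝ => |Real.exp x - 1|) (𝓝 0) (𝓝 0) := by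
      have hc : Continuous fun x : ℝ => |Real.exp x - 1| := by fun_prop
      simpa using hc.tendsto 0
    refine (hcont.comp hz).congr fun i => ?_
    simp only [Function.comp_apply, key]
  · -- the basis vectors are joint eigenvectors
    intro i
    refine ⟨B i, B.orthonormal.ne_zero i, fun t => ?_⟩
    show B.diagonalCLM (m t) (B i) = _
    rw [B.diagonalCLM_basis, hm_apply]

/-- **`AsymptoticCriticalLine → BandRealisation`** (the route's calibration / honesty support
`AsymptoticToRealisation`, proved): index `ℓ²` by the zeros `ρ` of `ζ` in the open critical
strip and take the diagonal group with characters `e^{t(ρ - 1/2)}` (`exists_diagonalGroup`);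
`AsymptoticCriticalLine` — for every `ε > 0` only finitely many such zeros have
`|Re ρ - 1/2| ≥ ε` — is exactly the statement that `Re ρ - 1/2 → 0` along the cofinite filter of
the index set, which makes `T 1 -  diag(e^{i Im ρ})` compact. Hence the item `BandRealisation`
(stmt-RiemannHypothesis-2062) follows from the crux `AsymptoticCriticalLine`
(stmt-RiemannHypothesis-2063). [folklore] -/
theorem bandRealisation_of_asymptoticCriticalLine (hA : AsymptoticCriticalLine) :
    BandRealisation := by
  -- the index set: zeros of `ζ` in the open critical strip
  let ι : Type := {s : ℂ // riemannZeta s = 0 ∧ 0 < s.re ∧ s.re < 1}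
  have hre : ∀ i : ι, ((i : ℂ) - 1 / 2).re = (i : ℂ).re - 1 / 2 := fun i => by
    simp [Complex.sub_re]
  have hz : Tendsto (fun i : ι => ((i : ℂ) - 1 / 2).re) cofinite (𝓝 0) := by
    rw [Metric.tendsto_nhds]
    intro ε hε
    rw [Filter.eventually_cofinite]
    refine ((hA ε hε).preimage Subtype.val_injective.injOn).subset ?_
    intro i hi
    simp only [not_lt, dist_zero_right, Real.norm_eq_abs, hre] at hi
    exact ⟨i.2.1, i.2.2.1, i.2.2.2, hi⟩
  have hbdd : ∃ C : ℝ, ∀ i : ι, |((i : ℂ) - 1 / 2).re| ≤ C := by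
    refine ⟨1 / 2, fun i => ?_⟩
    have h1 := i.2.2.1
    have h2 := i.2.2.2
    rw [hre, abs_le]
    constructor <;> linarith
  obtain ⟨T, h0, hadd, hUK, heig⟩ :=
    exists_diagonalGroup (fun i : ι => (i : ℂ) - 1 / 2) hbdd hz
  refine ⟨ℓ²(ι, ℂ), inferInstance, inferInstance, inferInstance, T, h0, hadd, hUK, ?_⟩
  intro s hs h0' h1
  exact heig ⟨s, hs, h0', h1⟩

/-- **`RiemannHypothesis → BandRealisation`**: RH empties every band, so `AsymptoticCriticalLine`
holds (crux disprover's `Negative.Ladder.not_riemannHypothesis_of_not_acl`), and the diagonal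
model realises it. Contrapositively, a refutation of the item `BandRealisation`
(stmt-RiemannHypothesis-2062) would be a disproof of the Riemann Hypothesis: the item cannot be
settled on the negative side short of `¬RH`. [folklore] -/
theorem bandRealisation_of_riemannHypothesis (hRH : RiemannHypothesis) : BandRealisation :=
  Classical.byContradiction fun h =>
    AsymptoticCriticalLine.Negative.not_riemannHypothesis_of_not_acl
      (fun hacl => h (bandRealisation_of_asymptoticCriticalLine hacl)) hRH

end Summit.RiemannHypothesis.RiemannHypothesis.Theorems

end
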